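import Mathlib
import Literature.Analysis.FluidPDE.VectorCalculus

/-!
# Tool stub `stub_clebschCriticalPointIsSteadyEuler` of the line `Sketch`
# (crux `DyadicWallCascade.HalfSpaceHierarchy`, item stmt-AnomalousDissipation-18627)

Sorry-free discharge of the registered tool stub `stub_clebschCriticalPointIsSteadyEuler` of the
lead's skeleton `Cruxes/HalfSpaceHierarchy/Lines/Sketch.lean` (cards `octave-transfer-rpf`,
`flat-bernoulli-leaves`): the reconstruction step "a critical point of the Clebsch functional gives a
steady Euler pair" of the Buffoni–Wahlén / Grad–Rubin construction of steady Euler flows in Clebsch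
variables `V = ∇α × ∇β`.

**Statement (Clebsch / Grad–Rubin reconstruction).**  Let `U ⊆ ℝ³` be open, `α, β : ℝ³ → ℝ` of class
`C³` on `U`, `G : ℝ → ℝ` of class `C²`, and let `V : ℝ³ → ℝ³` be the field `V = ∇α × ∇β`.  If the
vorticity `ω = curl V` satisfies `⟪ω, ∇α⟫ = 0` and `⟪ω, ∇β⟫ = -G'(α)` on `U` (the Euler–Lagrange
equations of the Clebsch functional), then `(V, Q)` with the pressure `Q = G ∘ α − ‖V‖² / 2` is a
steady Euler pair on `U`:
`DV(X)[V X] + ∇(G ∘ α − ‖V‖² / 2)(X) = 0` for every `X ∈ U`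
(so the Bernoulli function `‖V‖² / 2 + Q` is `G ∘ α`).
Here `cross` / `curl` are the tree's `Literature.Analysis.FluidPDE.cross` / `.curl`
(`Literature/Analysis/FluidPDE/VectorCalculus.lean`) and `gradient`, `fderiv`, `deriv` are Mathlib's.

**Proof.**  Fix `X ∈ U` and write `a = ∇α(X)`, `b = ∇β(X)`, `v = V X = a × b`, `g = G'(α X)`,
`eᵢ = EuclideanSpace.single i 1`, `Dⱼᵢ = (DV(X) eⱼ)ᵢ = ∂ⱼVᵢ(X)` and
`ω = curl V X = (D₁₂ − D₂₁, D₂₀ − D₀₂, D₀₁ − D₁₀)`.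
* *Regularity.*  Since `U` is open, `α` is `C³` near `X`, so `Dα` is `C²` on `U`
  (`ContDiffOn.fderiv_of_isOpen`) and differentiable at `X`; the coordinates of `∇α` are the
  directional derivatives `(∇α)ᵢ = Dα eᵢ` (Riesz), so `∇α` is differentiable at `X`
  (`differentiableAt_euclidean`); likewise `∇β`.  Hence `V = ∇α × ∇β` is differentiable at `X` by the
  product rule for the cross product (`hasFDerivAt_cross` of `VectorCalculus.lean`); `α` is
  differentiable at `X` and `G` at `α X`.
* *The two terms in coordinates.*  By linearity, `(DV(X) v)ᵢ = Σⱼ vⱼ Dⱼᵢ` (expand `v = Σⱼ vⱼ eⱼ`).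
  By the chain rule for `G ∘ α` and for `‖·‖²` (Mathlib's `HasDerivAt.comp_hasFDerivAt`,
  `HasFDerivAt.norm_sq`), `(∇(G ∘ α − ‖V‖²/2)(X))ᵢ = g · aᵢ − ⟪v, DV(X) eᵢ⟫ = g aᵢ − Σⱼ vⱼ Dᵢⱼ`.
* *Algebra.*  With `v = a × b`, each coordinate of `Σⱼ vⱼ Dⱼᵢ + g aᵢ − Σⱼ vⱼ Dᵢⱼ` equals
  `aᵢ (⟪ω, b⟫ + g) − bᵢ ⟪ω, a⟫` — this is the coordinate form of the Lamb identity
  `(DV)V − ∇(‖V‖²/2) = −V × ω` combined with the triple product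
  `(a × b) × ω = ⟪a, ω⟫ b − ⟪b, ω⟫ a`; it is a polynomial identity in the `Dⱼᵢ, aⱼ, bⱼ, g`, closed by
  `ring` coordinate by coordinate.  The hypotheses `⟪ω, a⟫ = 0`, `⟪ω, b⟫ = −g` make it vanish.

Sources: B. Buffoni, E. Wahlén, *Steady three-dimensional rotational flows: an approach via two stream
functions and Nash–Moser iteration*, Anal. PDE 12 (2019), arXiv:1709.05957, Thm. 1.1 and §1 (the
Clebsch/Grad–Rubin reformulation — context only, nothing of it is formalised here); the vector
identities are folklore (A. J. Majda, A. L. Bertozzi, *Vorticity and Incompressible Flow*, CUP 2002,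
§1.1, eq. (1.33); H. Lamb, *Hydrodynamics*, 6th ed. (1932), Arts. 146, 165).  No named facts are used;
the only tree import is `VectorCalculus.lean` (`cross`, `curl`, `cross_apply`, `hasFDerivAt_cross`).
The private helpers `clebsch_gradient_coord`, `clebsch_clm_apply_coord` are private copies of
`gradient_coord`, `clm_apply_coord` of the sibling stub file
`DyadicWallCascadeHalfSpaceHierarchyLambVector.lean` (not imported, to keep the stub files independent).
Deliberately NOT here: incompressibility `div V = 0` of `V = ∇α × ∇β` (a separate identity), the
converse direction (the sibling Lamb-vector stub), and any existence statement for critical points.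
-/

set_option linter.dupNamespace false

noncomputable section

open scoped InnerProductSpace RealInnerProductSpace
open Literature.Analysis.FluidPDE

namespace Summit.AnomalousDissipation.AnomalousDissipation.Theorems.HalfSpaceHierarchy

/-- Coordinates of a gradient on `ℝ³` are the directional derivatives along the standard basis,
`(∇f X)ᵢ = Df(X) eᵢ` with `eᵢ = EuclideanSpace.single i 1` (Riesz representation, Mathlib's
`InnerProductSpace.toDual_symm_apply`).  Private copy of `gradient_coord` of the sibling stub file
`DyadicWallCascadeHalfSpaceHierarchyLambVector.lean`. [folklore] -/
private theorem clebsch_gradient_coord (f : EuclideanSpace ℝ (Fin 3) → ℝ)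
    (X : EuclideanSpace ℝ (Fin 3)) (i : Fin 3) :
    gradient f X i = fderiv ℝ f X (EuclideanSpace.single i 1) := by
  have h1 : ⟪gradient f X, EuclideanSpace.single i (1 : ℝ)⟫ = gradient f X i := by
    simp only [EuclideanSpace.inner_single_right, one_mul, RCLike.conj_to_real]
  rw [← h1, gradient, InnerProductSpace.toDual_symm_apply]

/-- Expansion of a continuous linear map of `ℝ³` in standard coordinates,
`(L v)ᵢ = Σⱼ vⱼ (L eⱼ)ᵢ`, from `v = Σⱼ vⱼ eⱼ` (`EuclideanSpace.basisFun`) and linearity.  Private copy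
of `clm_apply_coord` of the sibling stub file `DyadicWallCascadeHalfSpaceHierarchyLambVector.lean`.
[folklore] -/
private theorem clebsch_clm_apply_coord
    (L : EuclideanSpace ℝ (Fin 3) →L[ℝ] EuclideanSpace ℝ (Fin 3)) (v : EuclideanSpace ℝ (Fin 3))
    (i : Fin 3) : L v i = ∑ j, v j * L (EuclideanSpace.single j 1) i := by
  have hv : v = ∑ j, v j • EuclideanSpace.single j (1 : ℝ) := by
    simpa using ((EuclideanSpace.basisFun (Fin 3) ℝ).sum_repr v).symm
  conv_lhs => rw [hv]
  simp [map_sum, map_smul, Finset.sum_apply]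

/-- Regularity of a Clebsch potential: if `f` is `C³` on an open set `U ∋ X`, then the gradient
field `∇f` is differentiable at `X`.  Proof: `Df` is `C²` on `U` (`ContDiffOn.fderiv_of_isOpen`),
hence differentiable at `X`; each coordinate `(∇f)ᵢ = Df eᵢ` (`clebsch_gradient_coord`) is then
differentiable at `X`, and `differentiableAt_euclidean` concludes. [folklore] -/
private theorem clebsch_differentiableAt_gradient {f : EuclideanSpace ℝ (Fin 3) → ℝ}
    {U : Set (EuclideanSpace ℝ (Fin 3))} {X : EuclideanSpace ℝ (Fin 3)}
    (hU : IsOpen U) (hf : ContDiffOn ℝ 3 f U) (hX : X ∈ U) :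
    DifferentiableAt ℝ (gradient f) X := by
  have h1 : ContDiffOn ℝ 2 (fderiv ℝ f) U := hf.fderiv_of_isOpen hU (by norm_num)
  have h2 : DifferentiableAt ℝ (fderiv ℝ f) X :=
    (h1.contDiffAt (hU.mem_nhds hX)).differentiableAt two_ne_zero
  refine differentiableAt_euclidean.2 fun k => ?_
  have hk : (fun Y => gradient f Y k) = fun Y => fderiv ℝ f Y (EuclideanSpace.single k 1) :=
    funext fun Y => clebsch_gradient_coord f Y k
  rw [hk]
  exact h2.clm_apply (differentiableAt_const _)

/-- Coordinates of the pressure gradient: for `V`, `α` differentiable at `X` and `G` differentiable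
at `α X`,
`(∇(G ∘ α − ‖V‖² / 2)(X))ᵢ = G'(α X) · (∇α X)ᵢ − ⟪V X, DV(X) eᵢ⟫`
(chain rule for `G ∘ α`, Mathlib's `HasDerivAt.comp_hasFDerivAt`; chain rule for `‖·‖²`, Mathlib's
`HasFDerivAt.norm_sq`; coordinates of gradients via `clebsch_gradient_coord`). [folklore] -/
private theorem clebsch_gradient_pressure
    {V : EuclideanSpace ℝ (Fin 3) → EuclideanSpace ℝ (Fin 3)} {α : EuclideanSpace ℝ (Fin 3) → ℝ}
    {G : ℝ → ℝ} {X : EuclideanSpace ℝ (Fin 3)} (hV : DifferentiableAt ℝ V X)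
    (hα : DifferentiableAt ℝ α X) (hG : DifferentiableAt ℝ G (α X)) (i : Fin 3) :
    gradient (fun Y => G (α Y) - ‖V Y‖ ^ 2 / 2) X i =
      deriv G (α X) * gradient α X i - ⟪V X, fderiv ℝ V X (EuclideanSpace.single i 1)⟫ := by
  have h1 : HasFDerivAt (fun Y => G (α Y) - ‖V Y‖ ^ 2 * (2 : ℝ)⁻¹)
      (deriv G (α X) • fderiv ℝ α X -
        (2 : ℝ)⁻¹ • (2 • (innerSL ℝ (V X)).comp (fderiv ℝ V X))) X :=
    (hG.hasDerivAt.comp_hasFDerivAt X hα.hasFDerivAt).sub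
      (hV.hasFDerivAt.norm_sq.mul_const (2 : ℝ)⁻¹)
  have h2 : (fun Y => G (α Y) - ‖V Y‖ ^ 2 / 2) = fun Y => G (α Y) - ‖V Y‖ ^ 2 * (2 : ℝ)⁻¹ := by
    funext Y
    rw [div_eq_mul_inv]
  rw [clebsch_gradient_coord, clebsch_gradient_coord, h2, h1.fderiv]
  simp only [_root_.sub_apply, _root_.smul_apply, ContinuousLinearMap.comp_apply,
    innerSL_apply_apply, smul_eq_mul, nsmul_eq_mul, Nat.cast_ofNat]
  ring

/-- **Tool stub `stub_clebschCriticalPointIsSteadyEuler` (Clebsch / Grad–Rubin reconstruction).**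
For `U ⊆ ℝ³` open, `α, β ∈ C³(U)`, `G ∈ C²(ℝ)` and `V = ∇α × ∇β`: if `ω = curl V` satisfies
`⟪ω, ∇α⟫ = 0` and `⟪ω, ∇β⟫ = −G'(α)` on `U`, then `DV(X)[V X] + ∇(G ∘ α − ‖V‖²/2)(X) = 0` for all
`X ∈ U`, i.e. `(V, G ∘ α − ‖V‖²/2)` is a steady Euler pair on `U` with Bernoulli function `G ∘ α`.
Proof: coordinates at the fixed point `X` (Lamb identity and the triple-product expansion, both as
polynomial identities); see the module docstring (Buffoni–Wahlén, APDE 2019, Thm. 1.1 for the context;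
Majda–Bertozzi, *Vorticity and Incompressible Flow*, §1.1, eq. (1.33)). [folklore] -/
theorem stub_clebschCriticalPointIsSteadyEuler :
    ∀ (α β : EuclideanSpace ℝ (Fin 3) → ℝ) (G : ℝ → ℝ) (U : Set (EuclideanSpace ℝ (Fin 3)))
      (V : EuclideanSpace ℝ (Fin 3) → EuclideanSpace ℝ (Fin 3)), IsOpen U →
      ContDiffOn ℝ 3 α U → ContDiffOn ℝ 3 β U → ContDiff ℝ 2 G →
      (∀ X : EuclideanSpace ℝ (Fin 3), V X = Literature.Analysis.FluidPDE.cross (gradient α X) (gradient β X)) →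
      (∀ X ∈ U, inner ℝ (Literature.Analysis.FluidPDE.curl V X) (gradient α X) = 0) →
      (∀ X ∈ U, inner ℝ (Literature.Analysis.FluidPDE.curl V X) (gradient β X) = - deriv G (α X)) →
      ∀ X ∈ U, (fderiv ℝ V X) (V X) + gradient (fun Y => G (α Y) - ‖V Y‖ ^ 2 / 2) X = 0 := by
  intro α β G U V hU hα hβ hG hV h1 h2 X hX
  -- regularity at the point `X ∈ U`
  have hgα : DifferentiableAt ℝ (gradient α) X := clebsch_differentiableAt_gradient hU hα hX
  have hgβ : DifferentiableAt ℝ (gradient β) X := clebsch_differentiableAt_gradient hU hβ hX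
  have hVfun : V = fun Y => cross (gradient α Y) (gradient β Y) := funext hV
  have hVd : DifferentiableAt ℝ V X := by
    rw [hVfun]
    exact (hasFDerivAt_cross hgα.hasFDerivAt hgβ.hasFDerivAt).differentiableAt
  have hαd : DifferentiableAt ℝ α X :=
    (hα.contDiffAt (hU.mem_nhds hX)).differentiableAt three_ne_zero
  have hGd : DifferentiableAt ℝ G (α X) := hG.differentiable two_ne_zero (α X)
  -- the two terms of the momentum equation in coordinates
  have hconv : ∀ i : Fin 3, fderiv ℝ V X (V X) i =
      ∑ j, V X j * fderiv ℝ V X (EuclideanSpace.single j 1) i :=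
    fun i => clebsch_clm_apply_coord (fderiv ℝ V X) (V X) i
  have hpress : ∀ i : Fin 3, gradient (fun Y => G (α Y) - ‖V Y‖ ^ 2 / 2) X i =
      deriv G (α X) * gradient α X i - ⟪V X, fderiv ℝ V X (EuclideanSpace.single i 1)⟫ :=
    fun i => clebsch_gradient_pressure hVd hαd hGd i
  have hVX : V X = cross (gradient α X) (gradient β X) := hV X
  have h1X : ⟪curl V X, gradient α X⟫ = 0 := h1 X hX
  have h2X : ⟪curl V X, gradient β X⟫ = -deriv G (α X) := h2 X hX
  -- freeze the point values `a = ∇α X`, `b = ∇β X`, `g = G'(α X)`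
  set a : EuclideanSpace ℝ (Fin 3) := gradient α X
  set b : EuclideanSpace ℝ (Fin 3) := gradient β X
  set g : ℝ := deriv G (α X)
  ext i
  rw [PiLp.add_apply, PiLp.zero_apply, hconv i, hpress i, hVX]
  -- Lamb identity + triple product, coordinatewise: a polynomial identity in `Dⱼᵢ, aⱼ, bⱼ, g`
  trans a i * (⟪curl V X, b⟫ + g) - b i * ⟪curl V X, a⟫
  · fin_cases i <;> simp [cross, curl, cross_apply, PiLp.inner_apply, Fin.sum_univ_three] <;> ring
  · rw [h1X, h2X]
    ring

end Summit.AnomalousDissipation.AnomalousDissipation.Theorems.HalfSpaceHierarchy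

end
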